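import Literature.NumberTheory.GaloisRepresentations.WildInertiaComplement
import Mathlib.GroupTheory.Perm.Cycle.Type
import Mathlib.Data.Nat.Factorization.Basic
import HarnessLib

/-!
# Route UniversalToricDescent — the prime-to-`p` kernel `J_F ⊴ I_F` of the inertia group of an
# `ℓ`-adic local field (`ℓ ≠ p`): `I_F = cl⟨J_F, τ⟩` with `J_F` pro-prime-to-`p`

Lead prover bsd-wall-utd-p1 g10 (`--supports stmt-BirchSwinnertonDyer-20399`; structural input of the
Greenberg–Vatsal Prop. (2.4) local term at an ADDITIVE place). Greenberg–Vatsal (proof of Prop. (2.4)):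
"`I_ℓ` contains a unique subgroup `J_ℓ` such that `I_ℓ/J_ℓ ≅ ℤ_p(1)`; `J_ℓ` has profinite order prime
to `p`". For a non-archimedean local field `F` of characteristic `0` with residue characteristic
`ℓ ≠ p` and a tame `p`-generator `τ ∈ I_F` (every continuous homomorphism of `I_F` to a discrete
`p`-group has image `⟨f τ⟩`; such `τ` exist, `exists_tame_generator_continuousCohomology_absInertia`):

* `exists_proPrimeToP_normal_absInertia` — **there is a closed normal subgroup `J ⊴ I_F` which is
  pro-prime-to-`p`** (every open normal subgroup of `J` has index prime to `p`) **with `I_F = ⋃ₖ τᵏ J U`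
  for every open normal `U ⊴ I_F`** (`J` and `τ` topologically generate `I_F`).

`J` is the intersection of the open normal subgroups `U ⊴ I_F` with `I_F/U` a `p`-group (the kernel of
`I_F → I_F^{(p)} = ℤ_p(1)`). Generation: by compactness an open `V ⊇ J` contains such a `U`, and
`I_F/U = ⟨τ̄⟩`. Pro-`p′`: at an open normal level `W ⊴ I_F`, an element `yb` of order `p` in the image of
`J` in `I_F/W` maps to `1` in the ABELIAN quotient `I_F/(P_F W)` (`commutator_mem_absWildInertia`: its
image there is killed by `p` and by the prime-to-`p` part `m′` of `#(I_F/P_F W)`, because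
`x ↦ x̄^{m′}` is a continuous homomorphism onto a `p`-group, trivial on `J`), so `yb` lies in the image
of the wild inertia `P_F`, an `ℓ`-group (`isPGroup_map_absWildInertia_subgroupOf`) — contradiction.

THEOREMS ONLY; no definition, no named fact, no `sorry`. BSD is not advanced by this file.
References: [GreenbergVatsal2000] §2, proof of Prop. (2.4) (arXiv p. 22); [SerreLocalFields1979]
Ch. IV §2 Cor. 1 and Cor. 3 of Prop. 7; [SerreInventiones1972] §1.3.
-/

set_option autoImplicit false
-- `…BirchSwinnertonDyer.BirchSwinnertonDyer.Theorems…` is the problem's mandated namespace (D-0017).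
set_option linter.dupNamespace false

noncomputable section

open scoped Classical Pointwise Valued
open Field ValuativeRel

namespace Summit.BirchSwinnertonDyer.BirchSwinnertonDyer.Theorems.UniversalToricDescentInertiaPrimeToP

open Literature.NumberTheory.GaloisRepresentations
  Literature.NumberTheory.GaloisRepresentations.IsNonarchimedeanLocalField Function Topology

variable (F : Type) [Field F] [ValuativeRel F] [TopologicalSpace F] [IsNonarchimedeanLocalField F]

/-- **The prime-to-`p` kernel of inertia.** For a non-archimedean local field `F` of characteristic `0`
with residue characteristic `≠ p` and a tame `p`-generator `τ ∈ I_F`: there is a closed normal subgroup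
`J ⊴ I_F`, pro-prime-to-`p` (every open normal subgroup of `J` has index prime to `p`), such that
`I_F = ⋃ₖ τᵏ J U` for every open normal subgroup `U ⊴ I_F` (Greenberg–Vatsal's `J_ℓ`, with
`I_ℓ/J_ℓ ≅ ℤ_p(1)` topologically generated by `τ`). [cite: GreenbergVatsal2000, §2, proof of Prop. (2.4) (arXiv p. 22)]
[cite: SerreLocalFields1979, Ch. IV §2 Cor. 1 and Cor. 3 of Prop. 7] [cite: SerreInventiones1972, §1.3] -/
theorem exists_proPrimeToP_normal_absInertia [CharZero F] {p : ℕ} [hp : Fact p.Prime]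
    (hℓ : ringChar 𝓀[F] ≠ p) (τ : absInertia F)
    (hgen : ∀ (B : Type) [Group B] [TopologicalSpace B] [DiscreteTopology B], IsPGroup p B →
      ∀ f : absInertia F →* B, Continuous f → f.range = Subgroup.zpowers (f τ)) :
    ∃ J : Subgroup (absInertia F), J.Normal ∧ IsClosed (J : Set (absInertia F)) ∧
      (∀ U : Subgroup J, U.Normal → IsOpen (U : Set J) → U.index.Coprime p) ∧
      (∀ U : Subgroup (absInertia F), U.Normal → IsOpen (U : Set (absInertia F)) →
        ∀ σ : absInertia F, ∃ k : ℤ, ∃ n ∈ J, ∃ u ∈ U, σ = τ ^ k * n * u) := by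
  -- notation and topology
  let I : Subgroup (absoluteGaloisGroup F) := absInertia F
  haveI : CompactSpace (absoluteGaloisGroup F) := absoluteGaloisGroup_compactSpace F
  haveI : TotallyDisconnectedSpace (absoluteGaloisGroup F) := by
    change TotallyDisconnectedSpace (AlgebraicClosure F ≃ₐ[F] AlgebraicClosure F); infer_instance
  have hIcl : IsClosed (I : Set (absoluteGaloisGroup F)) := isClosed_absInertia_holds F
  haveI : CompactSpace I := isCompact_iff_compactSpace.mp hIcl.isCompact
  haveI : Fact (ringChar 𝓀[F]).Prime := ⟨ringChar_residueField_prime (F := F)⟩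
  have hℓp : ringChar 𝓀[F] ≠ p := hℓ
  -- the open normal subgroups with `p`-group quotient, and their intersection `J`
  let S : Set (OpenNormalSubgroup I) := {U | ∀ x : I, ∃ k : ℕ, x ^ p ^ k ∈ U}
  let J : Subgroup I := ⨅ U ∈ S, (U : OpenNormalSubgroup I).toSubgroup
  have hJmem : ∀ x : I, x ∈ J ↔ ∀ U ∈ S, x ∈ U := fun x ↦ by
    simp only [J, Subgroup.mem_iInf]
    rfl
  have hJle : ∀ U ∈ S, J ≤ U.toSubgroup := fun U hU x hx ↦ (hJmem x).mp hx U hU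
  -- `J` is normal and closed
  have hJnormal : J.Normal := ⟨fun n hn g ↦ (hJmem _).mpr fun U hU ↦
    U.isNormal'.conj_mem n ((hJmem n).mp hn U hU) g⟩
  have hJclosed : IsClosed (J : Set I) := by
    have : (J : Set I) = ⋂ U ∈ S, ((U : OpenNormalSubgroup I).toSubgroup : Set I) := by
      ext x
      simp only [SetLike.mem_coe, hJmem, Set.mem_iInter]
      rfl
    rw [this]
    exact isClosed_biInter fun U _ ↦ U.toOpenSubgroup.isClosed
  refine ⟨J, hJnormal, hJclosed, ?_, ?_⟩
  · /- `J` is pro-prime-to-`p` -/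
    intro V hVn hVopen
    -- an open normal `W ⊴ I` with `W ∩ J ⊆ V`
    obtain ⟨O, hO, hOV⟩ := isOpen_induced_iff.mp hVopen
    have h1O : (1 : I) ∈ O := by
      have h : (1 : J) ∈ (Subtype.val ⁻¹' O : Set J) := by rw [hOV]; exact V.one_mem
      exact h
    obtain ⟨W, hW⟩ := ProfiniteGrp.exist_openNormalSubgroup_sub_open_nhds_of_one hO h1O
    have hWV : (W.toSubgroup).subgroupOf J ≤ V := fun x hx ↦ by
      have : x ∈ (Subtype.val ⁻¹' O : Set J) := hW (Subgroup.mem_subgroupOf.mp hx)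
      rw [hOV] at this
      exact this
    refine Nat.Coprime.coprime_dvd_left (Subgroup.index_dvd_of_le hWV) ?_
    -- `(W ∩ J).index = #(image of J in I/W)`
    let π : I →* I ⧸ W.toSubgroup := QuotientGroup.mk' W.toSubgroup
    have hidx : ((W.toSubgroup).subgroupOf J).index = Nat.card (J.map π) := by
      rw [← MonoidHom.restrict_range, ← Subgroup.index_ker, MonoidHom.ker_restrict,
        QuotientGroup.ker_mk']
    rw [hidx]
    haveI : Finite (I ⧸ W.toSubgroup) := Subgroup.quotient_finite_of_isOpen _ W.isOpen'
    -- no element of order `p` in the image of `J`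
    rw [Nat.coprime_comm, Nat.Prime.coprime_iff_not_dvd hp.out]
    intro hdvd
    obtain ⟨yb, hyb⟩ := exists_prime_orderOf_dvd_card' p hdvd
    set y : I ⧸ W.toSubgroup := (yb : I ⧸ W.toSubgroup) with hydef
    have hy : orderOf y = p := by rw [hydef, Subgroup.orderOf_coe, hyb]
    obtain ⟨x, hxJ, hxy⟩ := Subgroup.mem_map.mp yb.2
    have hxy' : π x = y := hxy
    -- the wild inertia `P₁ ⊴ I` and the abelian quotient `I/(P₁ W)`
    obtain ⟨ϖ, hϖ⟩ := IsDiscreteValuationRing.exists_irreducible 𝒪[F]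
    haveI : (absWildInertia F ϖ).Normal := absWildInertia_normal F ϖ
    let P₁ : Subgroup I := (absWildInertia F ϖ).subgroupOf I
    haveI hP₁n : P₁.Normal := inferInstance
    let M : Subgroup I := P₁ ⊔ W.toSubgroup
    haveI hMn : M.Normal := Subgroup.sup_normal _ _
    have hWM : W.toSubgroup ≤ M := le_sup_right
    have hMopen : IsOpen (M : Set I) := Subgroup.isOpen_mono hWM W.isOpen'
    haveI : Finite (I ⧸ M) := Subgroup.quotient_finite_of_isOpen _ hMopen
    let g : I →* I ⧸ M := QuotientGroup.mk' M
    have hcomm : ∀ a b : I, Commute (g a) (g b) := fun a b ↦ by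
      rw [← commutatorElement_eq_one_iff_commute, ← map_commutatorElement, commutatorElement_def]
      show QuotientGroup.mk' M (a * b * a⁻¹ * b⁻¹) = 1
      rw [QuotientGroup.mk'_apply, QuotientGroup.eq_one_iff]
      refine Subgroup.mem_sup_left (Subgroup.mem_subgroupOf.mpr ?_)
      exact commutator_mem_absWildInertia hϖ.ne_zero a.2 b.2
    -- the prime-to-`p` part `m'` of `#(I/M)` and the homomorphism `x ↦ ḡ(x)^{m'}`
    set m : ℕ := Nat.card (I ⧸ M) with hm
    have hm0 : m ≠ 0 := Nat.card_pos.ne'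
    set m' : ℕ := ordCompl[p] m with hm'
    have hmm' : p ^ m.factorization p * m' = m := Nat.ordProj_mul_ordCompl_eq_self m p
    have hcop' : p.Coprime m' := Nat.coprime_ordCompl hp.out hm0
    let f : I →* I ⧸ M :=
      { toFun := fun x ↦ g x ^ m'
        map_one' := by simp
        map_mul' := fun a b ↦ by
          show g (a * b) ^ m' = g a ^ m' * g b ^ m'
          rw [map_mul, (hcomm a b).mul_pow] }
    have hf : ∀ x : I, f x = g x ^ m' := fun _ ↦ rfl
    have hMf : M ≤ f.ker := fun x hx ↦ by
      rw [MonoidHom.mem_ker, hf]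
      have : g x = 1 := by
        show QuotientGroup.mk' M x = 1
        rw [QuotientGroup.mk'_apply, QuotientGroup.eq_one_iff]; exact hx
      rw [this, one_pow]
    let Uf : OpenNormalSubgroup I :=
      { toSubgroup := f.ker
        isOpen' := Subgroup.isOpen_mono hMf hMopen
        isNormal' := inferInstance }
    have hUfS : Uf ∈ S := fun z ↦ ⟨m.factorization p, by
      show z ^ p ^ m.factorization p ∈ f.ker
      rw [MonoidHom.mem_ker, hf, map_pow, ← pow_mul, hmm', hm]
      exact pow_card_eq_one'⟩
    -- `x ∈ J ≤ ker f`: `ḡ(x)^{m'} = 1`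
    have hx1 : g x ^ m' = 1 := by
      have := hJle Uf hUfS hxJ
      exact this
    -- `ḡ(x) = h'(y)` with `h' : I/W → I/M`, and `h'(y)^p = 1`
    let h' : I ⧸ W.toSubgroup →* I ⧸ M :=
      QuotientGroup.map W.toSubgroup M (MonoidHom.id I) (fun w hw ↦ hWM hw)
    have hh' : h' y = g x := by
      rw [← hxy']
      rfl
    have hyp : h' y ^ p = 1 := by rw [← hy, ← map_pow, pow_orderOf_eq_one, map_one]
    have hgx : g x = 1 := by
      have h := pow_gcd_eq_one.mpr ⟨hh' ▸ hyp, hx1⟩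
      rwa [Nat.Coprime.gcd_eq_one hcop', pow_one] at h
    -- so `x ∈ P₁ W`, `y ∈ image of P₁`: an `ℓ`-group
    have hxM : x ∈ M := by
      have : QuotientGroup.mk' M x = 1 := hgx
      rwa [QuotientGroup.mk'_apply, QuotientGroup.eq_one_iff] at this
    have hyP : y ∈ P₁.map π := by
      have hxM' : (x : I) ∈ ((M : Subgroup I) : Set I) := hxM
      rw [Subgroup.normal_mul] at hxM'
      obtain ⟨q, hq, w, hw, hqw⟩ := Set.mem_mul.mp hxM'
      refine ⟨q, hq, ?_⟩
      rw [← hxy', ← hqw, map_mul]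
      have : π w = 1 := by
        show QuotientGroup.mk' W.toSubgroup w = 1
        rw [QuotientGroup.mk'_apply, QuotientGroup.eq_one_iff]; exact hw
      rw [this, mul_one]
    have hPgrp := isPGroup_map_absWildInertia_subgroupOf F hϖ W
    obtain ⟨c, hc⟩ := hPgrp ⟨y, hyP⟩
    have hyc : y ^ ringChar 𝓀[F] ^ c = 1 := by
      have := congrArg Subtype.val hc
      simpa using this
    have hdvd' : p ∣ ringChar 𝓀[F] ^ c := by
      rw [← hy]; exact orderOf_dvd_of_pow_eq_one hyc
    have := (Nat.prime_dvd_prime_iff_eq hp.out (Fact.out : (ringChar 𝓀[F]).Prime)).mp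
      (hp.out.dvd_of_dvd_pow hdvd')
    exact hℓp this.symm
  · /- `J` and `τ` topologically generate `I` -/
    intro U hUn hUopen σ
    let V : Subgroup I := J ⊔ U
    have hVopen : IsOpen (V : Set I) := Subgroup.isOpen_mono le_sup_right hUopen
    have hVcl : IsClosed ((V : Set I)ᶜ) := hVopen.isClosed_compl
    -- compactness: finitely many members of `S` already meet inside `V`
    obtain ⟨u, hu⟩ := hVcl.isCompact.elim_finite_subfamily_closed
      (fun U : S ↦ ((U.1 : OpenNormalSubgroup I).toSubgroup : Set I))
      (fun U ↦ U.1.toOpenSubgroup.isClosed) (by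
        apply Set.eq_empty_of_forall_notMem
        rintro x ⟨hxV, hxJ⟩
        apply hxV
        have hxJ' : x ∈ J := (hJmem x).mpr fun U hU ↦ by
          have := Set.mem_iInter.mp hxJ ⟨U, hU⟩
          exact this
        exact Subgroup.mem_sup_left hxJ')
    -- the finite intersection `U₀`, an open normal subgroup with `p`-group quotient, inside `V`
    let U₀ : Subgroup I := ⨅ U ∈ u, (U.1 : OpenNormalSubgroup I).toSubgroup
    have hU₀mem : ∀ x : I, x ∈ U₀ ↔ ∀ U ∈ u, x ∈ (U.1 : OpenNormalSubgroup I) := fun x ↦ by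
      simp only [U₀, Subgroup.mem_iInf]
      rfl
    have hU₀V : U₀ ≤ V := fun x hx ↦ by
      by_contra hxV
      have : x ∈ ((V : Set I)ᶜ ∩ ⋂ U ∈ u, ((U.1 : OpenNormalSubgroup I).toSubgroup : Set I)) :=
        ⟨hxV, Set.mem_iInter₂.mpr fun U hU ↦ (hU₀mem x).mp hx U hU⟩
      rw [hu] at this
      exact this
    haveI hU₀n : U₀.Normal := ⟨fun n hn g ↦ (hU₀mem _).mpr fun U hU ↦
      U.1.isNormal'.conj_mem n ((hU₀mem n).mp hn U hU) g⟩
    have hU₀open : IsOpen (U₀ : Set I) := by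
      have : (U₀ : Set I) = ⋂ U ∈ u, ((U.1 : OpenNormalSubgroup I).toSubgroup : Set I) := by
        ext x
        simp only [SetLike.mem_coe, hU₀mem, Set.mem_iInter₂]
        rfl
      rw [this]
      exact isOpen_biInter_finset fun U _ ↦ U.1.isOpen'
    have hU₀p : ∀ x : I, ∃ k : ℕ, x ^ p ^ k ∈ U₀ := by
      intro x
      choose k hk using fun U : S ↦ U.2 x
      refine ⟨u.sum k, (hU₀mem _).mpr fun U hU ↦ ?_⟩
      have hle : k U ≤ u.sum k := Finset.single_le_sum (fun _ _ ↦ Nat.zero_le _) hU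
      rw [← Nat.add_sub_cancel' hle, pow_add, pow_mul]
      exact (U.1 : OpenNormalSubgroup I).toSubgroup.pow_mem (hk U) _
    -- `I/U₀ = ⟨τ̄⟩`
    haveI : DiscreteTopology (I ⧸ U₀) := QuotientGroup.discreteTopology hU₀open
    have hPG : IsPGroup p (I ⧸ U₀) := by
      intro z
      induction z using QuotientGroup.induction_on with
      | H x =>
        obtain ⟨k, hk⟩ := hU₀p x
        exact ⟨k, by rw [← QuotientGroup.mk_pow, QuotientGroup.eq_one_iff]; exact hk⟩
    have hrange := hgen (I ⧸ U₀) hPG (QuotientGroup.mk' U₀) QuotientGroup.continuous_mk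
    have hσ : QuotientGroup.mk' U₀ σ ∈ Subgroup.zpowers (QuotientGroup.mk' U₀ τ) := by
      rw [← hrange]; exact ⟨σ, rfl⟩
    obtain ⟨k, hk⟩ := Subgroup.mem_zpowers_iff.mp hσ
    have hu₀ : (τ ^ k)⁻¹ * σ ∈ U₀ := by
      rw [← QuotientGroup.eq, ← QuotientGroup.mk'_apply, ← QuotientGroup.mk'_apply, map_zpow]
      exact hk
    have hu₀V : ((τ ^ k)⁻¹ * σ : I) ∈ ((V : Subgroup I) : Set I) := hU₀V hu₀
    rw [Subgroup.normal_mul] at hu₀V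
    obtain ⟨n, hn, w, hw, hnw⟩ := Set.mem_mul.mp hu₀V
    refine ⟨k, n, hn, w, hw, ?_⟩
    rw [mul_assoc, hnw, mul_inv_cancel_left]

end Summit.BirchSwinnertonDyer.BirchSwinnertonDyer.Theorems.UniversalToricDescentInertiaPrimeToP

end
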